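import Literature.MathematicalPhysics.QuantumFieldTheory.Balaban1983to89.B11Eq44CLetterTower
import Literature.MathematicalPhysics.QuantumFieldTheory.Balaban1983to89.B7Prop5General
import Literature.MathematicalPhysics.QuantumFieldTheory.Balaban1983to89.B9Ineq3137LocalSup
import Literature.MathematicalPhysics.QuantumFieldTheory.Balaban1983to89.B11Eq90Transpose
import Literature.MathematicalPhysics.QuantumFieldTheory.Balaban1983to89.B7Prop5LineDerivFiniteFamily
import Literature.MathematicalPhysics.QuantumFieldTheory.Balaban1983to89.B7Eq141TorusImagesCount

/-!
# `Balaban1983to89.B11Eq44CKernelColumnTower` — T. Bałaban, *The variational problem and background fields in renormalization group method for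
lattice gauge theories*, Commun. Math. Phys. **102** (1985) 277–309 [Balaban1985Variational], (44) p. 285, (73) p. 289, Prop. 4 (97)–(98) pp. 292–293,
with [Balaban1985Averaging] (= [4]) Proposition 5 (157) p. 42, (137)–(138) p. 39, (141) p. 39, p. 24: **THE KERNEL LETTER OF THE (44)-LETTER `C_k`
BETWEEN THE CARRIERS OF (115) — [4] PROP. 5 (157) «|(δ/δA_b)C_k(U₀, A, c)| ≦ C₃|A|» TRANSFERRED FROM `ℤ^d` TO THE TORUS LETTER `Cck` OF THE
`k`-LEVEL CHAIN: per entry `‖(DC_k(Y)·(X·δ_b))(c)‖ ≤ C₃·(Lᵏη)·‖Y‖·N(c, b)L^{−kd}·‖X‖` (`N(c, b) ≤ 2^d` the images of `b` in `Bᵏ(c₋) ∪ Bᵏ(c₊)`) and per fine column `Σ_c ≤ C₃·(Lᵏη)·‖Y‖·2^d·2d·L^{−kd}·‖X‖`,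
`C₃ = C3Gen d L` a `(d, L)`-constant, NO lattice count** — the brick behind a lattice-free `θ_E`∕`θ₃` of the (98)-slot of `W = (δ/δA′)V`
(`B11Eq98CurrentSlot.quadAnalytic_W80`; today per lattice by `B11Ineq73KernelLettersPerLattice`∕`…Uniform`, whose column constant `κ` counts bonds)

statement-level skeleton of published theorems with citation tags; proofs where landed; nothing here is a claim about the Yang–Mills mass gap

PDF held: `paper:balaban1985-cmp98-averaging` (journal page = PDF page + 16), pp. 39–42 [PDF 23–26] ((137)–(157), Prop. 5) through the verbatim
quotations of `B7Prop5General` ∕ `B7Prop5GeneralInduction`; `paper:balaban1985-cmp102-variational-background` p. 285 (44), p. 289 (73), pp. 292–293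
(97)–(98) through `B11Eq44COperatorTower` ∕ `B11Eq98CurrentSlot`.

THE PRINT (verbatim).  [4] p. 42: *«Thus we have proved Proposition 5. The functional derivative of Q_k(U₀, ηA) is a bounded function for α₀, α₁
sufficiently small, and we have the bounds |(δ/δA_b)Q_k(U₀, ηA, c)| ≦ 1 + 2C′₁α₀ + C₃|A| < 1 + 2C′₁α₀ + C₃α₁, (156) |(δ/δA_b)C_k(U₀, A, c)| ≦ C₃|A| <
C₃α₁. (157)»*; p. 39 after (138): *«the functional derivative coincides with partial derivatives (gradient) of F(A) multiplied by η^{−d}»*; p. 24: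
*«Ū^k_c, c ⊂ Ω^{(k)}, depends only on the bond variables U_b for b ⊂ B^k(c₋) ∪ B^k(c₊)»*.  [B11] p. 289 (73): *«|𝔇(A′; c, b)| ≦ O(1)C₃ε₃(Lʲη)^{−d+1}
e^{−(1/2)δ₀d(c₋,y)}»*; p. 293: *«C₄ depend[s] on d and L only»*.

WHY THIS FILE (cell context, pub-balaban NE9; ne9-leaf-01 g96 `LOCATED-after-g96.md` §2 (W)(i)).  The lattice-uniform `cur U` chart
(`Support/NE9CurChartTowerPiLatticeUniformClass`, g96) takes the (L3) slot `W` with constants `(C₄, a₃)` fixed BEFORE the lattice; for the CONCRETE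
`W80` the per-lattice suppliers bound the kernel columns of `(HD)′(A′) = H∘C′_k(A)∘T′(A′)` through OPERATOR norms times the bond count `κ(∇)`.  The
lattice-free route is print's KERNEL route (73) → (86): the coarse-column kernel letter of `C′_k` (THIS FILE: `O(η^d)` per fine bond, from [4] Prop. 5,
which the tree holds on `ℤ^d` as `B7Prop5General.prop5_general_157`) × the fine-column letter of `H` (`O(η^{−d})`, sequel) × a Neumann series for `T′`.

DICTIONARY.  Fine torus `T_{Lᵏm}` (bonds `Bond d (towerP L m k)`), coarse torus `T_m`; `Ũ`, `ηÃ` the periodic extensions (`perCfg`); representatives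
`liftSite` in `[0, P)`, `P_i = Lᵏm_i`; period vectors `periodVec P t`.  `C_k` at the carrier = `B11Eq44CLetterTower.Cck` (= `quadOf Cblockk`), its entry
at `(c, b)` = the Fréchet partial `(D Cck(Y)·(X·δ_b))(c)` (`B11Eq90Transpose.single115`, `NegSup.equiv … c`); [4]'s line derivative (137) =
`B7Prop5GeneralInduction.dCov`; the box indicator of (141) = `kerQdd`; `C₃ = B7Prop5GeneralLevels.C3Gen d L`, `θ = thetaGen d L α₀`.

WHAT IS PROVED (sorry-free; NO definition, no named fact; nothing of the papers asserted: (157) enters as the crews' THEOREM; companions of this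
generation `B7Eq141TorusImagesCount` (period images in `[0, 2P)`, the coarse-column count) and `B7Prop5LineDerivFiniteFamily` (Gateaux-linearity of
`C_k(U₀, ·)(c)` on finite families) REUSED BY NAME).
* §1 `Cblockk_eq_CCovIter` (rfl), `perCfg_smul_line`, `agreeOn_perCfg_single` (locality meets periodicity), **`fderiv_Cblockk_single`** — THE PARTIAL
  DERIVATIVE OF THE TORUS REMAINDER IN ONE TORUS BOND `b` = `Σ_{t∈{0,1}^d} dC_k(B; ηX·δ_{x̃+Pt})(c̃)` (torus analyticity `analyticAt_Cblockk`, locality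
  `CCovIter_congr`, `lineDeriv_CCovIter_sum`).
* §2 **`norm_fderiv_Cck_single_apply_le`** — the per-entry letter: `‖(DC_k(Y)·(X·δ_b))(c)‖ ≤ C₃·(Lᵏη)·‖Y‖·(Σ_t kerQdd(c̃; x̃+Pt, μ))·‖X‖` (the image
  count carries (141)'s weight `L^{−kd}`); **`opNorm_fderiv_Cck_entry_le`** (the entry as a fibre operator); **`sum_opNorm_fderiv_Cck_entry_le`** — the
  per-fine-column letter `Σ_c ‖k_{DC_k(Y)}(c, b)‖ ≤ C₃·(Lᵏη)·‖Y‖·2^d·2d·L^{−kd}`.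
HYPOTHESES (displayed, those of `B11Eq44CLetterTower` §6 + Prop. 5's smallness): `2 ≤ L`; [4] Prop. 2's data on `U` (`AvgClosed G`, (52), `C₀α₀ ≤ 1/3`,
`4α₀ ≤ c₂′`); `k ≤ lev₀`; the radius `ρ` with `e^{4cα₀}(1 + 8C₁ρ) ≤ 2`, **`4ρ ≤ c₃`**, **`2dC₃ρ ≤ 1`**, and **`2d·θ ≤ L³/16`** (a window on `α₀`; the last
three are (145)/(155) via `smallness_sufficient`).
HONEST SCOPE.  (i) NO exponential decay (print's (73) carries `e^{−½δ₀d}`; not needed for the column sums).  (ii) The fine-column letter of `H`, the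
composition (86) and the assembly of a lattice-free `C₄` are NOT here (sequels).  (iii) On the diagonal `Lᵏη = 1`, `c₀ = η^d = L^{−kd}` the letter reads
`C₃η^d‖Y‖`; off it the factors are displayed as printed here.  (iv) NOT summit progress (cell pub-balaban: NE9 NOT PRINTED ∕ NOT PROVED; «NE9 ⇐ the named
binders»; row WALLED ON A MODEL (O-NE9-1); spine PROVED 0∕9; rung (B)+1 on a finite T⁴ — NOT infinite volume, NOT mass gap, NOT BetaPertH, NOT Clay;
HONEST DEPENDENCY: continuum YM on T⁴ ⇐ BetaPertH ∧ nine spine estimates (0/9 proved); BetaPertH ⇐ (D1) ∧ (D4) ∧ CAP+tail; G-an2-4 gates asym, D1 and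
NE2/3/4).  Filed by the NE9 crux-team leaf seat `b2b-balaban-t4-ne9-formalise-leaf-01` (gen 97); NEW file; imports `B11Eq44CLetterTower`, `B7Prop5General`,
`B9Ineq3137LocalSup`, `B11Eq90Transpose`, `B7Prop5LineDerivFiniteFamily`, `B7Eq141TorusImagesCount`; nothing modified.  Net new unproved facts: 0.
-/

noncomputable section

open scoped BigOperators
open Finset Metric Set

namespace Literature.MathematicalPhysics.QuantumFieldTheory.Balaban1983to89.B11Eq44CKernelColumnTower

open B7Prop1Local (InBox AgreeOn loK bondHiK)
open B7Prop2Explicit (pdev AvgClosed C0 c2')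
open B7Prop3Flat (c3)
open B7Prop5Flat (bump BondIn)
open B7Prop4GeneralLevels (logCovIter linCovIter)
open B7Prop5GeneralOperators (kerQdd kerQdd_of_bondIn kerQdd_of_not_bondIn kerQdd_nonneg)
open B7Prop5GeneralInduction (CCovIter dCov)
open B7Prop5GeneralLevels (thetaGen C3Gen hadd_levels hsmul_levels)
open B7Prop5General (prop5_general_157 smallness_sufficient)
open B9Eq315QTorus (perSite perCfg perCfg_apply)
open B9Eq315QTorusOnto (liftSite periodVec perSite_add_periodVec liftSite_perSite_add perSite_liftSite)
open B9Eq315QTower (towerP towerP_apply)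
open B9Ineq3137LocalSup (CCovIter_congr)
open B11Eq44COperatorTower (Cblockk Cblockk_apply analyticAt_Cblockk norm_perCfg_smul_le)
open B11Eq44CLetterTower (Cck equiv_Cck_apply eta_mul_norm_le_of_weight_k smallness_mono analyticOnNhd_Cck)
open B11Eq115Space
open B11Eq90Transpose (single115 flat115_single115)
open B7Prop5LineDerivFiniteFamily (lineDeriv_CCovIter_sum)
open B7Eq141TorusImagesCount (single_perSite_eq_sum_bump inBox_tower_bounds sum_images_kerQdd_le)
open B9SectCLatticeCarrier (Bond)
open B4Sect5Torus (TSite)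

-- `Site` alone would resolve to the torus sites of `Setup.lean`; re-export the `ℤ^d` sites of `B7Prop1Explicit`.
export B7Prop1Explicit (Site)

variable {d : ℕ}

/-! ## §1 The partial derivative of the torus remainder `Cblockk` in one torus bond -/

section Torus

variable {𝔸 : Type*} [NormedRing 𝔸] [NormedAlgebra ℂ 𝔸] [CompleteSpace 𝔸] [NormOneClass 𝔸]
  (L : ℕ) [NeZero L] (m : Fin d → ℕ) [∀ i, NeZero (m i)] (η : ℝ) (k : ℕ) (U : Bond d (towerP L m k) → 𝔸ˣ)
  (hL : 2 ≤ L) {G : Subgroup 𝔸ˣ} (hG : AvgClosed d L G)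
  (hU : ∀ (x : Site d) (κ : Fin d), perCfg (towerP L m k) U x κ ∈ G) {α₀ : ℝ} (hα : 0 < α₀)
  (hα3 : C0 d * α₀ ≤ 1 / 3) (hα4 : 4 * α₀ ≤ c2' d L) (h52 : pdev (perCfg (towerP L m k) U) < α₀ * (((L : ℝ) ^ k)⁻¹) ^ 2) (hη : 0 < η)

omit [NormOneClass 𝔸] in
/-- The torus remainder of (44) IS the crews' `C_k(U₀, ·)` (`CCovIter`, [4] (150)) of the periodic extensions at the representative bond.
[cite: Balaban1985Variational, (44) p.285; Balaban1985Averaging, (150) p.40, (134) p.38] -/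
theorem Cblockk_eq_CCovIter (A : Bond d (towerP L m k) → 𝔸) (c : Bond d m) :
    Cblockk L m η k U A c = CCovIter L (perCfg (towerP L m k) U) (perCfg (towerP L m k) ((η : ℂ) • A)) k (liftSite c.1) c.2 := rfl

omit [CompleteSpace 𝔸] [NormOneClass 𝔸] in
/-- Along the torus line `A + t·(X·δ_b)` the periodic extension moves along the `ℤ^d` line `B + t·D`, `D` the periodic extension of `η·X·δ_b`.
[cite: Balaban1985Averaging, (1) p.17, (137) p.39] -/
theorem perCfg_smul_line (A : Bond d (towerP L m k) → 𝔸) (b : Bond d (towerP L m k)) (X : 𝔸) (t : ℂ) :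
    perCfg (towerP L m k) ((η : ℂ) • (A + t • (Pi.single b X : Bond d (towerP L m k) → 𝔸))) =
      perCfg (towerP L m k) ((η : ℂ) • A) + t • perCfg (towerP L m k) ((η : ℂ) • (Pi.single b X : Bond d (towerP L m k) → 𝔸)) := by
  funext x κ
  simp only [perCfg_apply, Pi.add_apply, Pi.smul_apply, smul_add, smul_comm (η : ℂ) t]

omit [CompleteSpace 𝔸] [NormOneClass 𝔸] in
/-- **Locality meets periodicity**: on the box `Bᵏ(c₋) ∪ Bᵏ(c₊)` of a unit-torus bond the periodic extension of `η·X·δ_b` agrees with the finite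
sum of the `2^d` single-bond bumps at the period images of `b` (§1 + §2). [cite: Balaban1985Averaging, p.24 (after (43)), (1) p.17] -/
theorem agreeOn_perCfg_single (hL1 : 1 ≤ L) (B : Site d → Fin d → 𝔸) (xb : TSite d (towerP L m k)) (μb : Fin d) (X : 𝔸)
    (c : Bond d m) (t : ℂ) :
    AgreeOn (loK L k (liftSite c.1)) (bondHiK L k (liftSite c.1) c.2)
      (B + t • perCfg (towerP L m k) ((η : ℂ) • (Pi.single (xb, μb) X : Bond d (towerP L m k) → 𝔸)))
      (B + t • ∑ s ∈ (Fintype.piFinset fun _ : Fin d => ({0, 1} : Finset ℤ)), bump (liftSite xb + periodVec (towerP L m k) s) μb ((η : ℂ) • X)) := by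
  intro x μ hx _
  have h := single_perSite_eq_sum_bump (towerP L m k) xb μb ((η : ℂ) • X) x μ
    (fun i => (inBox_tower_bounds L m k hL1 c.1 c.2 hx i).1) (fun i => (inBox_tower_bounds L m k hL1 c.1 c.2 hx i).2)
  simp only [Pi.add_apply, Pi.smul_apply, Finset.sum_apply, perCfg_apply]
  rw [← h]
  simp only [Pi.single_apply, smul_ite, smul_zero]

include hL hG hU hα hα3 hα4 h52 hη in
/-- **THE PARTIAL DERIVATIVE OF THE TORUS REMAINDER `A ↦ C_k(LᵏηA)(c)` IN ONE TORUS BOND `b` IS THE SUM OF [4] PROP. 5's LINE DERIVATIVES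
`dC_k(B; ηX·δ_{b̃})(c̃)` OVER THE `2^d` PERIOD IMAGES `b̃` of `b`** (`B` = the periodic extension of `ηA`, `c̃` the representative of `c`):
torus analyticity (`analyticAt_Cblockk`) ⇒ the Fréchet partial is the line derivative; the torus line is the `ℤ^d` line along the periodic
direction; LOCALITY (`CCovIter_congr`) replaces that direction by the finite sum of bumps; §4 splits the line derivative over the images.
[cite: Balaban1985Averaging, Prop. 5 (157) p.42, (137)–(138) p.39, (127) p.37, p.24; Balaban1985Variational, (44) p.285] -/
theorem fderiv_Cblockk_single [FiniteDimensional ℂ 𝔸] (A : Bond d (towerP L m k) → 𝔸) {a : ℝ} (ha : 0 ≤ a) (hA : ∀ b, η * ‖A b‖ ≤ a)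
    (hsmall : Real.exp (4 * (800 * ((d : ℝ) + 1) ^ 2 * ((d : ℝ) + 4)) * α₀) * (1 + 8 * (131072 * ((d : ℝ) + 1) ^ 2) * ((L : ℝ) ^ k * a)) ≤ 2)
    (hc₃ : 2 * ((L : ℝ) ^ k * a) ≤ c3 d L) (b : Bond d (towerP L m k)) (X : 𝔸) (c : Bond d m) :
    fderiv ℂ (fun A' : Bond d (towerP L m k) → 𝔸 => Cblockk L m η k U A' c) A (Pi.single b X) =
      ∑ s ∈ (Fintype.piFinset fun _ : Fin d => ({0, 1} : Finset ℤ)), dCov L (perCfg (towerP L m k) U) (perCfg (towerP L m k) ((η : ℂ) • A))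
        (bump (liftSite b.1 + periodVec (towerP L m k) s) b.2 ((η : ℂ) • X)) k (liftSite c.1) c.2 := by
  classical
  obtain ⟨xb, μb⟩ := b
  have hL1 : 1 ≤ L := le_trans (by norm_num) hL
  have hBa : ∀ x κ', ‖perCfg (towerP L m k) ((η : ℂ) • A) x κ'‖ ≤ a := norm_perCfg_smul_le L m η k hη.le A hA
  -- the torus block map is differentiable at `A`: its Fréchet partial is the line derivative
  have hGd : DifferentiableAt ℂ (fun A' : Bond d (towerP L m k) → 𝔸 => Cblockk L m η k U A' c) A :=
    (analyticAt_Cblockk L m η k U hL hG hU hα hα3 hα4 h52 hη.le A ha hA hsmall hc₃ c).differentiableAt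
  rw [← hGd.lineDeriv_eq_fderiv]
  -- the torus line read on `ℤ^d`, then localised to the finite sum of bumps
  have hval : ∀ t : ℂ, Cblockk L m η k U (A + t • (Pi.single (xb, μb) X : Bond d (towerP L m k) → 𝔸)) c =
      CCovIter L (perCfg (towerP L m k) U) (perCfg (towerP L m k) ((η : ℂ) • A) +
        t • ∑ s ∈ (Fintype.piFinset fun _ : Fin d => ({0, 1} : Finset ℤ)), bump (liftSite xb + periodVec (towerP L m k) s) μb ((η : ℂ) • X)) k (liftSite c.1) c.2 := by
    intro t
    rw [Cblockk_eq_CCovIter, perCfg_smul_line L m η k A (xb, μb) X t]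
    exact CCovIter_congr L hL1 k (liftSite c.1) c.2 (fun _ _ _ _ => rfl) (agreeOn_perCfg_single L m η k hL1 _ xb μb X c t)
  have hld : lineDeriv ℂ (fun A' : Bond d (towerP L m k) → 𝔸 => Cblockk L m η k U A' c) A (Pi.single (xb, μb) X) =
      lineDeriv ℂ (fun B' => CCovIter L (perCfg (towerP L m k) U) B' k (liftSite c.1) c.2) (perCfg (towerP L m k) ((η : ℂ) • A))
        (∑ s : ↥(Fintype.piFinset fun _ : Fin d => ({0, 1} : Finset ℤ)), bump (liftSite xb + periodVec (towerP L m k) (s : Site d)) μb ((η : ℂ) • X)) := by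
    unfold lineDeriv
    simp_rw [hval, Finset.sum_coe_sort (Fintype.piFinset fun _ : Fin d => ({0, 1} : Finset ℤ)) (fun s => bump (liftSite xb + periodVec (towerP L m k) s) μb ((η : ℂ) • X))]
  rw [hld, (lineDeriv_CCovIter_sum L hL hG k (perCfg (towerP L m k) U) hU hα hα3 hα4 h52 _ ha hBa hsmall hc₃
    (fun s : ↥(Fintype.piFinset fun _ : Fin d => ({0, 1} : Finset ℤ)) => bump (liftSite xb + periodVec (towerP L m k) (s : Site d)) μb ((η : ℂ) • X)) (liftSite c.1) c.2).2,
    Finset.sum_coe_sort (Fintype.piFinset fun _ : Fin d => ({0, 1} : Finset ℤ))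
      (fun s => dCov L (perCfg (towerP L m k) U) (perCfg (towerP L m k) ((η : ℂ) • A))
        (bump (liftSite xb + periodVec (towerP L m k) s) μb ((η : ℂ) • X)) k (liftSite c.1) c.2)]

end Torus

/-! ## §2 The kernel letter of the (44)-letter `C_k` between the carriers of (115): per entry and per fine column -/

section Letter

variable {𝔸 : Type*} [NormedRing 𝔸] [NormedAlgebra ℂ 𝔸] [CompleteSpace 𝔸] [NormOneClass 𝔸] [FiniteDimensional ℂ 𝔸]
  (L : ℕ) [NeZero L] (m : Fin d → ℕ) [∀ i, NeZero (m i)] (η : ℝ) (k : ℕ) (U : Bond d (towerP L m k) → 𝔸ˣ)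
  {κ' : Type*} [Fintype κ'] (lev₀ : Bond d (towerP L m k) → ℕ) (lev₁ : κ' → ℕ)
  (Dc : (Bond d (towerP L m k) → 𝔸) →ₗ[ℂ] (κ' → 𝔸)) (levB : Bond d m → ℕ) [Fact (0 < (L : ℝ))] [Fact (0 < η)]
  (hL : 2 ≤ L) {G : Subgroup 𝔸ˣ} (hG : AvgClosed d L G)
  (hU : ∀ (x : Site d) (κ : Fin d), perCfg (towerP L m k) U x κ ∈ G) {α₀ : ℝ} (hα : 0 < α₀)
  (hα3 : C0 d * α₀ ≤ 1 / 3) (hα4 : 4 * α₀ ≤ c2' d L) (h52 : pdev (perCfg (towerP L m k) U) < α₀ * (((L : ℝ) ^ k)⁻¹) ^ 2)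
  (hlev : ∀ b, k ≤ lev₀ b) {ρ : ℝ}
  (hρ : Real.exp (4 * (800 * ((d : ℝ) + 1) ^ 2 * ((d : ℝ) + 4)) * α₀) * (1 + 8 * (131072 * ((d : ℝ) + 1) ^ 2) * ρ) ≤ 2)
  (hρ4 : 4 * ρ ≤ c3 d L) (hθ : 2 * d * thetaGen d L α₀ ≤ (L : ℝ) ^ 3 / 16) (hC3 : 2 * d * C3Gen d L * ρ ≤ 1)

include hL hG hU hα hα3 hα4 h52 hlev hρ hρ4 hθ hC3 in
/-- **THE KERNEL LETTER OF `C_k` AT THE CARRIER, PER ENTRY** — [4] Proposition 5 (157) «|(δ/δA_b)C_k(U₀, A, c)| ≦ C₃|A|» transferred to the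
(44)-letter `Cck` between the carriers of (115): on the ball `‖Y‖_{(115)} < ρ` (`ρ` below [4] Prop. 4's smallness, `4ρ ≤ c₃`, `2dC₃ρ ≤ 1`, and
`2d·θ ≤ L³/16` on `α₀` — Prop. 5's «α₀, α₁ sufficiently small», `B7Prop5General.smallness_sufficient`), for every fine torus bond `b`, fibre
direction `X` and coarse torus bond `c`:
`‖(DC_k(Y)·(X·δ_b))(c)‖ ≤ C₃·(Lᵏη)·‖Y‖·(Σ_{t∈{0,1}^d} kerQdd(c̃; x̃ + Pt, μ))·‖X‖`, `C₃ = C3Gen d L` («d and L only»), the sum = `L^{−kd}` × the number (`≤ 2^d`,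
summing to `≤ 2^d·2d` over `c`) of period images of `b` in `Bᵏ(c₋) ∪ Bᵏ(c₊)` — on the diagonal `Lᵏη = 1`, `L^{−kd} = η^d` this is `C₃η^d‖Y‖·N·‖X‖`, print's
(73)-type kernel size `O(|A′|)` in the (138) normalisation WITHOUT the decay factor.  Proof: §1's identity + (157) per image (zero off the box).
[cite: Balaban1985Averaging, Prop. 5 (157) p.42, (141) p.39; Balaban1985Variational, (44) p.285, (73) p.289] -/
theorem norm_fderiv_Cck_single_apply_le {Y : Space115 (L : ℝ) η lev₀ lev₁ Dc} (hY : ‖Y‖ < ρ) (b : Bond d (towerP L m k)) (X : 𝔸)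
    (c : Bond d m) :
    ‖NegSup.equiv (levWeight (L : ℝ) η levB 0) 𝔸 (fderiv ℂ (Cck L m η k U lev₀ lev₁ Dc levB) Y
        (single115 (L := (L : ℝ)) (η := η) (lev₀ := lev₀) (lev₁ := lev₁) (Dc := Dc) b X)) c‖ ≤
      C3Gen d L * ((L : ℝ) ^ k * η) * ‖Y‖ * (∑ t ∈ (Fintype.piFinset fun _ : Fin d => ({0, 1} : Finset ℤ)),
        kerQdd L k (liftSite c.1) c.2 (liftSite b.1 + periodVec (towerP L m k) t) b.2) * ‖X‖ := by
  classical
  have hL1 : 1 ≤ L := le_trans (by norm_num) hL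
  have hL1r : (1 : ℝ) ≤ L := by exact_mod_cast hL1
  have hLk : (0 : ℝ) < (L : ℝ) ^ k := by positivity
  have hη0 : 0 < η := Fact.out
  set A : Bond d (towerP L m k) → 𝔸 := JetSup.equiv (levWeight (L : ℝ) η lev₀ 1) (levWeight (L : ℝ) η lev₁ 2) Dc Y with hA
  -- the regime in Prop. 5's variables: `|B| ≤ a = ‖Y‖/Lᵏ`, `Lᵏa = ‖Y‖ < ρ`
  set a : ℝ := ‖Y‖ / (L : ℝ) ^ k with ha_def
  have ha : 0 ≤ a := by positivity
  have hLa : (L : ℝ) ^ k * a = ‖Y‖ := mul_div_cancel₀ _ hLk.ne'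
  have hAa : ∀ b', η * ‖A b'‖ ≤ a :=
    eta_mul_norm_le_of_weight_k L m η k lev₀ hlev hL1r hη0.le A (fun b' => JetSup.weight_mul_norm_apply_le Y b')
  have hsmall : Real.exp (4 * (800 * ((d : ℝ) + 1) ^ 2 * ((d : ℝ) + 4)) * α₀) *
      (1 + 8 * (131072 * ((d : ℝ) + 1) ^ 2) * ((L : ℝ) ^ k * a)) ≤ 2 := by rw [hLa]; exact smallness_mono hY.le hρ
  have hc₃ : 2 * ((L : ℝ) ^ k * a) ≤ c3 d L := by rw [hLa]; linarith [norm_nonneg Y]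
  have hc₃' : 4 * ((L : ℝ) ^ k * a) < c3 d L := by rw [hLa]; linarith
  have hC3' : 2 * d * C3Gen d L * ((L : ℝ) ^ k * a) ≤ 1 := by
    rw [hLa]
    have hC30 : 0 ≤ 2 * d * C3Gen d L := by unfold C3Gen B7Prop5GeneralLevels.C1ppGen; positivity
    exact (mul_le_mul_of_nonneg_left hY.le hC30).trans hC3
  obtain ⟨h145, h155⟩ := smallness_sufficient hL d k hα.le hθ hC3'
  have hBa : ∀ x κ, ‖perCfg (towerP L m k) ((η : ℂ) • A) x κ‖ ≤ a := norm_perCfg_smul_le L m η k hη0.le A hAa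
  -- the flattening of (115) as a continuous linear map; the block value `c` of `C_k` is the torus block map after it
  set Fl : Space115 (L : ℝ) η lev₀ lev₁ Dc →L[ℂ] (Bond d (towerP L m k) → 𝔸) :=
    ContinuousLinearMap.pi fun b' => JetSup.evalCLM (levWeight (L : ℝ) η lev₀ 1) (levWeight (L : ℝ) η lev₁ 2) Dc b' with hFl
  have hFlY : Fl Y = A := rfl
  have hFlb : Fl (single115 (L := (L : ℝ)) (η := η) (lev₀ := lev₀) (lev₁ := lev₁) (Dc := Dc) b X) = Pi.single b X := rfl
  have hcomp : (fun Z : Space115 (L : ℝ) η lev₀ lev₁ Dc => NegSup.equiv (levWeight (L : ℝ) η levB 0) 𝔸 (Cck L m η k U lev₀ lev₁ Dc levB Z) c) =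
      (fun A' : Bond d (towerP L m k) → 𝔸 => Cblockk L m η k U A' c) ∘ Fl := rfl
  -- the entry is the Fréchet partial of the torus block map
  have hCck : DifferentiableAt ℂ (Cck L m η k U lev₀ lev₁ Dc levB) Y :=
    (analyticOnNhd_Cck L m η k U lev₀ lev₁ Dc levB hL hG hU hα hα3 hα4 h52 hlev hρ (by linarith [norm_nonneg Y]) Y hY).differentiableAt
  have hGd : DifferentiableAt ℂ (fun A' : Bond d (towerP L m k) → 𝔸 => Cblockk L m η k U A' c) (Fl Y) :=
    (analyticAt_Cblockk L m η k U hL hG hU hα hα3 hα4 h52 hη0.le A ha hAa hsmall hc₃ c).differentiableAt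
  have hentry : NegSup.equiv (levWeight (L : ℝ) η levB 0) 𝔸 (fderiv ℂ (Cck L m η k U lev₀ lev₁ Dc levB) Y
        (single115 (L := (L : ℝ)) (η := η) (lev₀ := lev₀) (lev₁ := lev₁) (Dc := Dc) b X)) c =
      fderiv ℂ (fun A' : Bond d (towerP L m k) → 𝔸 => Cblockk L m η k U A' c) A (Pi.single b X) := by
    have h1 : fderiv ℂ ((NegSup.evalCLM ℂ (levWeight (L : ℝ) η levB 0) c) ∘ Cck L m η k U lev₀ lev₁ Dc levB) Y =
        (NegSup.evalCLM ℂ (levWeight (L : ℝ) η levB 0) c).comp (fderiv ℂ (Cck L m η k U lev₀ lev₁ Dc levB) Y) :=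
      ((NegSup.evalCLM ℂ (levWeight (L : ℝ) η levB 0) c).hasFDerivAt.comp Y hCck.hasFDerivAt).fderiv
    have h2 : fderiv ℂ (fun Z => NegSup.equiv (levWeight (L : ℝ) η levB 0) 𝔸 (Cck L m η k U lev₀ lev₁ Dc levB Z) c) Y =
        (fderiv ℂ (fun A' : Bond d (towerP L m k) → 𝔸 => Cblockk L m η k U A' c) (Fl Y)).comp Fl := by
      rw [hcomp]
      exact (hGd.hasFDerivAt.comp Y Fl.hasFDerivAt).fderiv
    have h12 : (NegSup.evalCLM ℂ (levWeight (L : ℝ) η levB 0) c).comp (fderiv ℂ (Cck L m η k U lev₀ lev₁ Dc levB) Y) =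
        (fderiv ℂ (fun A' : Bond d (towerP L m k) → 𝔸 => Cblockk L m η k U A' c) (Fl Y)).comp Fl := h1.symm.trans h2
    have h3 := congrArg (fun T => T (single115 (L := (L : ℝ)) (η := η) (lev₀ := lev₀) (lev₁ := lev₁) (Dc := Dc) b X)) h12
    simp only [ContinuousLinearMap.comp_apply, NegSup.evalCLM_apply, hFlb] at h3
    exact h3
  rw [hentry, fderiv_Cblockk_single L m η k U hL hG hU hα hα3 hα4 h52 hη0 A ha hAa hsmall hc₃ b X c]
  -- Prop. 5 (157) per image, zero off the box
  have hker : ∀ s : Site d, ‖dCov L (perCfg (towerP L m k) U) (perCfg (towerP L m k) ((η : ℂ) • A))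
        (bump (liftSite b.1 + periodVec (towerP L m k) s) b.2 ((η : ℂ) • X)) k (liftSite c.1) c.2‖ ≤
      C3Gen d L * ((L : ℝ) ^ k) ^ 2 * a * (η * ‖X‖) * kerQdd L k (liftSite c.1) c.2 (liftSite b.1 + periodVec (towerP L m k) s) b.2 := by
    intro s
    obtain ⟨-, hbd, hzero⟩ := prop5_general_157 L hL hG k (perCfg (towerP L m k) U) hU hα hα3 hα4 h52
      (perCfg (towerP L m k) ((η : ℂ) • A)) ha hBa hsmall hc₃' h145 h155 (liftSite b.1 + periodVec (towerP L m k) s) b.2 ((η : ℂ) • X)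
      le_rfl (liftSite c.1) c.2
    have hηX : ‖(η : ℂ) • X‖ = η * ‖X‖ := by rw [norm_smul, Complex.norm_real, Real.norm_of_nonneg hη0.le]
    by_cases hin : BondIn (loK L k (liftSite c.1)) (bondHiK L k (liftSite c.1) c.2) (liftSite b.1 + periodVec (towerP L m k) s) b.2
    · rw [kerQdd_of_bondIn hin, ← hηX]
      refine hbd.trans (le_of_eq ?_)
      ring
    · rw [hzero hin, kerQdd_of_not_bondIn hin, norm_zero, mul_zero]
  calc ‖∑ s ∈ (Fintype.piFinset fun _ : Fin d => ({0, 1} : Finset ℤ)), dCov L (perCfg (towerP L m k) U) (perCfg (towerP L m k) ((η : ℂ) • A))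
          (bump (liftSite b.1 + periodVec (towerP L m k) s) b.2 ((η : ℂ) • X)) k (liftSite c.1) c.2‖
      ≤ ∑ s ∈ (Fintype.piFinset fun _ : Fin d => ({0, 1} : Finset ℤ)), ‖dCov L (perCfg (towerP L m k) U) (perCfg (towerP L m k) ((η : ℂ) • A))
          (bump (liftSite b.1 + periodVec (towerP L m k) s) b.2 ((η : ℂ) • X)) k (liftSite c.1) c.2‖ := norm_sum_le _ _
    _ ≤ ∑ s ∈ (Fintype.piFinset fun _ : Fin d => ({0, 1} : Finset ℤ)), C3Gen d L * ((L : ℝ) ^ k) ^ 2 * a * (η * ‖X‖) *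
          kerQdd L k (liftSite c.1) c.2 (liftSite b.1 + periodVec (towerP L m k) s) b.2 := Finset.sum_le_sum fun s _ => hker s
    _ = C3Gen d L * ((L : ℝ) ^ k * η) * ‖Y‖ * (∑ t ∈ (Fintype.piFinset fun _ : Fin d => ({0, 1} : Finset ℤ)),
          kerQdd L k (liftSite c.1) c.2 (liftSite b.1 + periodVec (towerP L m k) t) b.2) * ‖X‖ := by
        rw [← Finset.mul_sum, ← hLa]
        ring

include hL hG hU hα hα3 hα4 h52 hlev hρ hρ4 hθ hC3 in
/-- **THE KERNEL ENTRY AS AN OPERATOR**: `‖k_{DC_k(Y)}(c, b)‖ ≤ C₃(Lᵏη)‖Y‖·Σ_t kerQdd(c̃; x̃ + Pt, μ)` for the fibre operator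
`X ↦ (DC_k(Y)·(X·δ_b))(c)`. [cite: Balaban1985Averaging, Prop. 5 (157) p.42; Balaban1985Variational, (73) p.289] -/
theorem opNorm_fderiv_Cck_entry_le {Y : Space115 (L : ℝ) η lev₀ lev₁ Dc} (hY : ‖Y‖ < ρ) (b : Bond d (towerP L m k)) (c : Bond d m) :
    ‖(NegSup.evalCLM ℂ (levWeight (L : ℝ) η levB 0) c).comp ((fderiv ℂ (Cck L m η k U lev₀ lev₁ Dc levB) Y).comp
        (single115 (L := (L : ℝ)) (η := η) (lev₀ := lev₀) (lev₁ := lev₁) (Dc := Dc) b))‖ ≤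
      C3Gen d L * ((L : ℝ) ^ k * η) * ‖Y‖ * (∑ t ∈ (Fintype.piFinset fun _ : Fin d => ({0, 1} : Finset ℤ)),
        kerQdd L k (liftSite c.1) c.2 (liftSite b.1 + periodVec (towerP L m k) t) b.2) := by
  have hC30 : 0 ≤ C3Gen d L := by unfold C3Gen B7Prop5GeneralLevels.C1ppGen; positivity
  have hη0 : 0 < η := Fact.out
  have hK : 0 ≤ C3Gen d L * ((L : ℝ) ^ k * η) * ‖Y‖ * (∑ t ∈ (Fintype.piFinset fun _ : Fin d => ({0, 1} : Finset ℤ)),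
      kerQdd L k (liftSite c.1) c.2 (liftSite b.1 + periodVec (towerP L m k) t) b.2) := by
    have := Finset.sum_nonneg fun t (_ : t ∈ (Fintype.piFinset fun _ : Fin d => ({0, 1} : Finset ℤ))) =>
      kerQdd_nonneg L k (liftSite c.1) c.2 (liftSite b.1 + periodVec (towerP L m k) t) b.2
    positivity
  refine ContinuousLinearMap.opNorm_le_bound _ hK fun X => ?_
  simpa only [ContinuousLinearMap.comp_apply, NegSup.evalCLM_apply] using
    norm_fderiv_Cck_single_apply_le L m η k U lev₀ lev₁ Dc levB hL hG hU hα hα3 hα4 h52 hlev hρ hρ4 hθ hC3 hY b X c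

include hL hG hU hα hα3 hα4 h52 hlev hρ hρ4 hθ hC3 in
/-- **THE KERNEL LETTER OF `C_k`, PER FINE COLUMN**: summed over the coarse torus bonds, `Σ_c ‖k_{DC_k(Y)}(c, b)‖ ≤ C₃·(Lᵏη)·‖Y‖·2^d·2d·L^{−kd}` —
one fine bond moves the block remainders by `O(L^{−kd}) = O(η^d)` IN TOTAL, linearly in the size of the point (the coarse-column half of print's
«C₄ depends on d and L only», (97)/(98), through the kernel route (73) → (86)). [cite: Balaban1985Averaging, Prop. 5 (157) p.42, (141)–(142) p.39; Balaban1985Variational, (73) p.289, Prop. 4 (97)–(98) pp.292–293] -/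
theorem sum_opNorm_fderiv_Cck_entry_le {Y : Space115 (L : ℝ) η lev₀ lev₁ Dc} (hY : ‖Y‖ < ρ) (b : Bond d (towerP L m k)) :
    ∑ c : Bond d m, ‖(NegSup.evalCLM ℂ (levWeight (L : ℝ) η levB 0) c).comp ((fderiv ℂ (Cck L m η k U lev₀ lev₁ Dc levB) Y).comp
        (single115 (L := (L : ℝ)) (η := η) (lev₀ := lev₀) (lev₁ := lev₁) (Dc := Dc) b))‖ ≤
      C3Gen d L * ((L : ℝ) ^ k * η) * ‖Y‖ * (2 ^ d * (2 * d) * (((L : ℝ) ^ k) ^ d)⁻¹) := by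
  have hL1 : 1 ≤ L := le_trans (by norm_num) hL
  have hC30 : 0 ≤ C3Gen d L := by unfold C3Gen B7Prop5GeneralLevels.C1ppGen; positivity
  have hη0 : 0 < η := Fact.out
  have hK : 0 ≤ C3Gen d L * ((L : ℝ) ^ k * η) * ‖Y‖ := by positivity
  calc _ ≤ ∑ c : Bond d m, C3Gen d L * ((L : ℝ) ^ k * η) * ‖Y‖ * (∑ t ∈ (Fintype.piFinset fun _ : Fin d => ({0, 1} : Finset ℤ)),
          kerQdd L k (liftSite c.1) c.2 (liftSite b.1 + periodVec (towerP L m k) t) b.2) :=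
        Finset.sum_le_sum fun c _ => opNorm_fderiv_Cck_entry_le L m η k U lev₀ lev₁ Dc levB hL hG hU hα hα3 hα4 h52 hlev hρ hρ4 hθ hC3 hY b c
    _ = C3Gen d L * ((L : ℝ) ^ k * η) * ‖Y‖ * ∑ c : Bond d m, ∑ t ∈ (Fintype.piFinset fun _ : Fin d => ({0, 1} : Finset ℤ)),
          kerQdd L k (liftSite c.1) c.2 (liftSite b.1 + periodVec (towerP L m k) t) b.2 := by rw [Finset.mul_sum]
    _ ≤ _ := mul_le_mul_of_nonneg_left (sum_images_kerQdd_le L m k hL1 b) hK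

end Letter

end Literature.MathematicalPhysics.QuantumFieldTheory.Balaban1983to89.B11Eq44CKernelColumnTower

end
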